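import Mathlib
import HarnessLib
import Literature.Analysis.FluidPDE.RadialCalculus
import Literature.Analysis.FluidPDE.HarmonicRemovableSingularity
import Literature.Analysis.PDE.LoewnerNirenbergKelvin
import Summits.NavierStokesRegularity.NavierStokesRegularity.Theorems.TypeIQuarterGateScarEnvelopeTypeIForcedTsaiDipoleTail

/-!
# ARM B — EXACT PART OF DATUM B-2j (iii): the STOKESLET `U_e(y) = e/|y| + ⟪e,y⟫y/|y|³` with pressure
  `P_e(y) = 2⟪e,y⟫/|y|³` solves the LINEARISED Leray profile system exactly on `ℝ³ ∖ {0}`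
  (ns-wall-extremal, eng-1 lineage g4, 2026-08-29)

WHAT IS PROVED (theorem-only; explicit fields).  With `U_e(y) := (‖y‖²)^{−1/2} • e + ((‖y‖²)^{−3/2}·⟪e,y⟫) • y`
and `P_e(y) := 2·(‖y‖²)^{−3/2}·⟪e,y⟫`, for every `e : ℝ³` and `x ≠ 0`:
* `laplacian_dipolePotential` : the dipole potential `y ↦ (‖y‖²)^{−3/2}⟪e,y⟫` is harmonic off `0`
  (from `laplacian_dipoleTail`, p-id of `…ForcedTsaiDipoleTail`, via a rank-one `L`);
* `laplacian_stokeslet` : `ΔU_e(x) = 2·∇((‖y‖²)^{−3/2}⟪e,y⟫)(x) = ∇P_e(x)` (Stokes' equations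
  `−ΔU_e + ∇P_e = 0`), using the monopole harmonicity `Δ(1/|y|) = 0` of the tree
  (`laplacian_norm_sub_sq_rpow_eq_zero`) and the local Leibniz rule `laplacian_smul_apply`;
* `stokeslet_homogeneous` : `U_e(t•y) = t⁻¹ • U_e(y)` (`t > 0`), so by p688729 the Leray drift
  `½U_e + ½DU_e·y` vanishes;
* ★ `stokeslet_linearisedLerayProfile` :
  `−ΔU_e(x) + ½U_e(x) + ½DU_e(x)[x] + ∇P_e(x) = 0` — the profile equation of `IsLerayProfile 1 ½`
  (NRŠ (1.4)) WITHOUT the convective term holds exactly off the origin.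

MEANING (HOME/ARM-B/linfloor-eng1g4/LINEAR-FLOOR.md §1 (iv), §3): the far field of the linear-floor
mode is this Stokeslet (its vorticity is the dipole tail of `…ForcedTsaiDipoleTail`); it carries no
registered residual at linear order — the reason the Type-I-tailed floor is 14.858 while fast-decaying
classes pay 27.767.  HONEST FRAME: pointwise identities for explicit fields; nothing about the wall H3,
crux `ScarEnvelopeTypeI` (stmt-23843, OPEN) or Navier–Stokes regularity (NOT proved).
-/

noncomputable section

set_option linter.dupNamespace false

namespace Summit.NavierStokesRegularity.NavierStokesRegularity.Cruxes.ScarEnvelopeTypeI.ForcedTsai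

open scoped Laplacian RealInnerProductSpace InnerProductSpace
open Literature.Analysis.FluidPDE Literature.Analysis.PDE Set Filter Module

/-! ## The dipole potential `(‖y‖²)^{-3/2}⟪e,y⟫` is harmonic off the origin -/

/-- The dipole potential is `C²` off the origin. -/
theorem contDiffAt_dipolePotential (e : E3) {x : E3} (hx : x ≠ 0) :
    ContDiffAt ℝ 2 (fun y : E3 => (‖y‖ ^ 2) ^ (-(3 : ℝ) / 2) * ⟪e, y⟫) x :=
  (contDiffAt_norm_sq_rpow_neg_three_halves hx).mul (innerSL ℝ e).contDiff.contDiffAt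

/-- **The dipole potential `y ↦ (‖y‖²)^{-3/2}⟪e,y⟫ = ⟪e,y⟫/|y|³` is harmonic off the origin.** -/
theorem laplacian_dipolePotential (e : E3) {x : E3} (hx : x ≠ 0) :
    (Δ (fun y : E3 => (‖y‖ ^ 2) ^ (-(3 : ℝ) / 2) * ⟪e, y⟫)) x = 0 := by
  -- a fixed non-zero direction `e₀` and the rank-one map `L y = ⟪e,y⟫ • e₀`
  set e₀ : E3 := EuclideanSpace.single 0 1 with he₀
  have he₀ne : e₀ ≠ 0 := by
    intro h
    have := congrArg (fun v : E3 => v 0) h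
    simp [he₀] at this
  set L : E3 →L[ℝ] E3 := (innerSL ℝ e : E3 →L[ℝ] ℝ).smulRight e₀ with hL
  set l : ℝ →L[ℝ] E3 := (ContinuousLinearMap.id ℝ ℝ).smulRight e₀ with hl
  -- the dipole tail of `L` is `l ∘ (dipole potential)`
  have hcomp : (fun y : E3 => (‖y‖ ^ 2) ^ (-(3 : ℝ) / 2) • L y)
      = l ∘ (fun y : E3 => (‖y‖ ^ 2) ^ (-(3 : ℝ) / 2) * ⟪e, y⟫) := by
    funext y
    simp [hL, hl, smul_smul]
  have h1 := laplacian_dipoleTail L hx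
  rw [hcomp, (contDiffAt_dipolePotential e hx).laplacian_CLM_comp_left, Function.comp_apply] at h1
  have h2 : ((Δ (fun y : E3 => (‖y‖ ^ 2) ^ (-(3 : ℝ) / 2) * ⟪e, y⟫)) x) • e₀ = 0 := by
    simpa [hl] using h1
  exact (smul_eq_zero.mp h2).resolve_right he₀ne

/-! ## The monopole `(‖y‖²)^{-1/2} = 1/|y|` is harmonic off the origin (tree, `finrank = 3`) -/

/-- `Δ(1/|y|) = 0` off the origin in `ℝ³` (the tree's Newtonian comparison function at `p = 0`). -/
theorem laplacian_norm_sq_rpow_neg_half {x : E3} (hx : x ≠ 0) :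
    (Δ (fun y : E3 => (‖y‖ ^ 2) ^ (-(1 : ℝ) / 2))) x = 0 := by
  have h := laplacian_norm_sub_sq_rpow_eq_zero (E := E3) (0 : E3) hx
  have hfun : (fun w : E3 => (‖w - 0‖ ^ 2) ^ (-(((finrank ℝ E3 : ℝ) - 2) / 2)))
      = fun y : E3 => (‖y‖ ^ 2) ^ (-(1 : ℝ) / 2) := by
    funext w
    rw [sub_zero, finrank_euclideanSpace_fin]
    norm_num
  rwa [hfun] at h

/-- The monopole factor is `C²` off the origin. -/
theorem contDiffAt_norm_sq_rpow_neg_half {x : E3} (hx : x ≠ 0) :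
    ContDiffAt ℝ 2 (fun y : E3 => (‖y‖ ^ 2) ^ (-(1 : ℝ) / 2)) x := by
  have hσ : (‖x‖ ^ 2) ≠ 0 := by positivity
  exact ((contDiff_norm_sq ℝ (E := E3)).contDiffAt).rpow_const_of_ne hσ

/-! ## The Stokeslet -/

/-- **Laplacian of the Stokeslet**: `Δ((‖y‖²)^{-1/2} • e + ((‖y‖²)^{-3/2}⟪e,y⟫) • y)(x) =
2 Σᵢ ∂ᵢ((‖y‖²)^{-3/2}⟪e,y⟫)(x) • bᵢ` (twice the gradient of the dipole potential), `x ≠ 0`. -/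
theorem laplacian_stokeslet (e : E3) {x : E3} (hx : x ≠ 0) :
    (Δ (fun y : E3 => (‖y‖ ^ 2) ^ (-(1 : ℝ) / 2) • e + ((‖y‖ ^ 2) ^ (-(3 : ℝ) / 2) * ⟪e, y⟫) • y)) x
      = (2 : ℝ) • ∑ i, (fderiv ℝ (fun y : E3 => (‖y‖ ^ 2) ^ (-(3 : ℝ) / 2) * ⟪e, y⟫) x
          (EuclideanSpace.basisFun (Fin 3) ℝ i)) • (EuclideanSpace.basisFun (Fin 3) ℝ i) := by
  set b := EuclideanSpace.basisFun (Fin 3) ℝ with hb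
  have hφ1 := contDiffAt_norm_sq_rpow_neg_half hx
  have hψ := contDiffAt_dipolePotential e hx
  have hconst : ContDiffAt ℝ 2 (fun _ : E3 => e) x := contDiffAt_const
  have hid : ContDiffAt ℝ 2 (fun y : E3 => y) x := contDiffAt_id
  have hA : ContDiffAt ℝ 2 (fun y : E3 => (‖y‖ ^ 2) ^ (-(1 : ℝ) / 2) • e) x := hφ1.smul hconst
  have hB : ContDiffAt ℝ 2 (fun y : E3 => ((‖y‖ ^ 2) ^ (-(3 : ℝ) / 2) * ⟪e, y⟫) • y) x :=
    hψ.smul hid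
  rw [show (fun y : E3 => (‖y‖ ^ 2) ^ (-(1 : ℝ) / 2) • e + ((‖y‖ ^ 2) ^ (-(3 : ℝ) / 2) * ⟪e, y⟫) • y)
      = (fun y : E3 => (‖y‖ ^ 2) ^ (-(1 : ℝ) / 2) • e) + fun y : E3 =>
          ((‖y‖ ^ 2) ^ (-(3 : ℝ) / 2) * ⟪e, y⟫) • y from rfl,
    hA.laplacian_add hB]
  -- first term: `Δ(φ₁ • e) = (Δφ₁) • e = 0`
  have hT1 : (Δ (fun y : E3 => (‖y‖ ^ 2) ^ (-(1 : ℝ) / 2) • e)) x = 0 := by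
    rw [LoewnerNirenberg.laplacian_smul_apply hφ1 hconst b, laplacian_norm_sq_rpow_neg_half hx]
    have hc : (Δ (fun _ : E3 => e)) x = 0 := by
      rw [InnerProductSpace.laplacian_eq_iteratedFDeriv_orthonormalBasis _ b]
      simp [iteratedFDeriv_two_apply]
    simp [hc]
  -- second term: `Δ(ψ • id) = 0 • x + 2 Σ ∂ᵢψ • bᵢ + ψ • 0`
  have hT2 : (Δ (fun y : E3 => ((‖y‖ ^ 2) ^ (-(3 : ℝ) / 2) * ⟪e, y⟫) • y)) x
      = (2 : ℝ) • ∑ i, (fderiv ℝ (fun y : E3 => (‖y‖ ^ 2) ^ (-(3 : ℝ) / 2) * ⟪e, y⟫) x (b i)) •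
          b i := by
    rw [LoewnerNirenberg.laplacian_smul_apply hψ hid b, laplacian_dipolePotential e hx, zero_smul,
      zero_add]
    have hΔid : (Δ (fun y : E3 => y)) x = 0 := by
      have := laplacian_clm (ContinuousLinearMap.id ℝ E3) x
      simpa using this
    rw [hΔid, smul_zero, add_zero]
    congr 1
    refine Finset.sum_congr rfl fun i _ => ?_
    rw [show (fun y : E3 => y) = id from rfl, fderiv_id]
    rfl
  rw [hT1, hT2, zero_add]

/-- The gradient of a differentiable scalar function in an orthonormal frame:
`∇f(x) = Σᵢ ∂ᵢf(x) • bᵢ`. -/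
theorem gradient_eq_sum_fderiv_smul {f : E3 → ℝ} {x : E3} {ι : Type*} [Fintype ι]
    (b : OrthonormalBasis ι ℝ E3) :
    gradient f x = ∑ i, (fderiv ℝ f x (b i)) • b i := by
  conv_lhs => rw [← b.sum_repr' (gradient f x)]
  refine Finset.sum_congr rfl fun i _ => ?_
  rw [real_inner_comm, gradient, InnerProductSpace.toDual_symm_apply]

/-- **Stokes' equations for the Stokeslet**: `ΔU_e(x) = ∇P_e(x)` with `P_e = 2(‖y‖²)^{-3/2}⟪e,y⟫`. -/
theorem laplacian_stokeslet_eq_gradient (e : E3) {x : E3} (hx : x ≠ 0) :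
    (Δ (fun y : E3 => (‖y‖ ^ 2) ^ (-(1 : ℝ) / 2) • e + ((‖y‖ ^ 2) ^ (-(3 : ℝ) / 2) * ⟪e, y⟫) • y)) x
      = gradient (fun y : E3 => 2 * ((‖y‖ ^ 2) ^ (-(3 : ℝ) / 2) * ⟪e, y⟫)) x := by
  set b := EuclideanSpace.basisFun (Fin 3) ℝ with hb
  have hψd : DifferentiableAt ℝ (fun y : E3 => (‖y‖ ^ 2) ^ (-(3 : ℝ) / 2) * ⟪e, y⟫) x :=
    (contDiffAt_dipolePotential e hx).differentiableAt (by norm_num)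
  rw [laplacian_stokeslet e hx, gradient_eq_sum_fderiv_smul b, Finset.smul_sum]
  refine Finset.sum_congr rfl fun i _ => ?_
  rw [fderiv_const_mul hψd, FunLike.coe_smul, Pi.smul_apply, smul_eq_mul, smul_smul]

/-- **The Stokeslet is `(−1)`-homogeneous**: `U_e(t•y) = t⁻¹ • U_e(y)` for `t > 0`. -/
theorem stokeslet_homogeneous (e y : E3) {t : ℝ} (ht : 0 < t) :
    (‖t • y‖ ^ 2) ^ (-(1 : ℝ) / 2) • e + ((‖t • y‖ ^ 2) ^ (-(3 : ℝ) / 2) * ⟪e, t • y⟫) • (t • y)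
      = t⁻¹ • ((‖y‖ ^ 2) ^ (-(1 : ℝ) / 2) • e + ((‖y‖ ^ 2) ^ (-(3 : ℝ) / 2) * ⟪e, y⟫) • y) := by
  have hn : ‖t • y‖ ^ 2 = t ^ 2 * ‖y‖ ^ 2 := by
    rw [norm_smul, Real.norm_eq_abs, abs_of_pos ht]; ring
  have ht2 : (t ^ 2 : ℝ) = t ^ (2 : ℝ) := by norm_cast
  have h1 : (t ^ 2 * ‖y‖ ^ 2) ^ (-(1 : ℝ) / 2) = t⁻¹ * (‖y‖ ^ 2) ^ (-(1 : ℝ) / 2) := by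
    rw [Real.mul_rpow (by positivity) (by positivity), ht2, ← Real.rpow_mul ht.le]
    norm_num [Real.rpow_neg_one]
  have h3 : (t ^ 2 * ‖y‖ ^ 2) ^ (-(3 : ℝ) / 2) = t ^ (-(3 : ℝ)) * (‖y‖ ^ 2) ^ (-(3 : ℝ) / 2) := by
    rw [Real.mul_rpow (by positivity) (by positivity), ht2, ← Real.rpow_mul ht.le]
    norm_num
  have h4 : t ^ (-(3 : ℝ)) * t * t = t⁻¹ := by
    rw [show t ^ (-(3 : ℝ)) * t * t = t ^ (-(3 : ℝ)) * t ^ (2 : ℝ) by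
      rw [← ht2]; ring, ← Real.rpow_add ht]
    norm_num [Real.rpow_neg_one]
  have hs : t ^ (-(3 : ℝ)) * (‖y‖ ^ 2) ^ (-(3 : ℝ) / 2) * (t * ⟪e, y⟫) * t
      = t⁻¹ * ((‖y‖ ^ 2) ^ (-(3 : ℝ) / 2) * ⟪e, y⟫) := by
    rw [← h4]; ring
  rw [hn, h1, h3, inner_smul_right, smul_add, smul_smul, smul_smul, smul_smul, hs]

/-- The Stokeslet is differentiable off the origin. -/
theorem differentiableAt_stokeslet (e : E3) {x : E3} (hx : x ≠ 0) :
    DifferentiableAt ℝ (fun y : E3 => (‖y‖ ^ 2) ^ (-(1 : ℝ) / 2) • e +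
      ((‖y‖ ^ 2) ^ (-(3 : ℝ) / 2) * ⟪e, y⟫) • y) x :=
  (((contDiffAt_norm_sq_rpow_neg_half hx).differentiableAt (by norm_num)).smul
      (differentiableAt_const e)).add
    (((contDiffAt_dipolePotential e hx).differentiableAt (by norm_num)).smul differentiableAt_id)

/-- ★ **The Stokeslet solves the linearised Leray profile system exactly off the origin**:
`−ΔU_e(x) + ½U_e(x) + ½DU_e(x)[x] + ∇P_e(x) = 0` for `x ≠ 0` — the profile equation of
`IsLerayProfile 1 ½` (NRŠ (1.4)) with the convective term dropped, for the explicit pair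
`U_e = e/|y| + ⟪e,y⟩y/|y|³`, `P_e = 2⟪e,y⟫/|y|³`.  (The far field of the linear-floor mode of
DATUM B-2j; zero registered residual at linear order.) -/
theorem stokeslet_linearisedLerayProfile (e : E3) {x : E3} (hx : x ≠ 0) :
    -((Δ (fun y : E3 => (‖y‖ ^ 2) ^ (-(1 : ℝ) / 2) • e +
          ((‖y‖ ^ 2) ^ (-(3 : ℝ) / 2) * ⟪e, y⟫) • y)) x)
      + (1 / 2 : ℝ) • ((‖x‖ ^ 2) ^ (-(1 : ℝ) / 2) • e + ((‖x‖ ^ 2) ^ (-(3 : ℝ) / 2) * ⟪e, x⟫) • x)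
      + (1 / 2 : ℝ) • fderiv ℝ (fun y : E3 => (‖y‖ ^ 2) ^ (-(1 : ℝ) / 2) • e +
          ((‖y‖ ^ 2) ^ (-(3 : ℝ) / 2) * ⟪e, y⟫) • y) x x
      + gradient (fun y : E3 => 2 * ((‖y‖ ^ 2) ^ (-(3 : ℝ) / 2) * ⟪e, y⟫)) x = 0 := by
  have hhom : ∀ t : ℝ, 0 < t →
      (fun y : E3 => (‖y‖ ^ 2) ^ (-(1 : ℝ) / 2) • e + ((‖y‖ ^ 2) ^ (-(3 : ℝ) / 2) * ⟪e, y⟫) • y)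
        (t • x) = t⁻¹ • (fun y : E3 => (‖y‖ ^ 2) ^ (-(1 : ℝ) / 2) • e +
          ((‖y‖ ^ 2) ^ (-(3 : ℝ) / 2) * ⟪e, y⟫) • y) x := fun t ht => stokeslet_homogeneous e x ht
  have hdrift := leray_drift_eq_zero_of_homogeneous_neg_one hhom (differentiableAt_stokeslet e hx)
  rw [laplacian_stokeslet_eq_gradient e hx, add_assoc (-(gradient _ x)), hdrift, add_zero,
    neg_add_cancel]

end Summit.NavierStokesRegularity.NavierStokesRegularity.Cruxes.ScarEnvelopeTypeI.ForcedTsai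

end
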